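import Mathlib
import Literature.MathematicalPhysics.QuantumManyBody.BoseEinsteinCondensation
import Literature.MathematicalPhysics.QuantumManyBody.BoseGasThermodynamicLimitRuelle
import Literature.MathematicalPhysics.QuantumManyBody.BoseGasEnergyDensityConvexity
import Summits.AtomisticToContinuum.BoseEinsteinCondensation.Theorems.SoloBlindFragmentedFamily

/-!
Solo residency `solo-AtomisticToContinuum-blind`, session 3 — the thermodynamic no-go.

Paper: run/shared/lean/ideation/AtomisticToContinuum/solo-blind/paper/paper.md, §11,
Proposition 11.1(c).

For a repulsive finite-range pair potential, a density `0 < ρ < ρ_c(v)` (Ruelle's critical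
density), any `q ≥ 1` and any `ε > 0`: eventually in `N`, the energy window of width `εN` above
the Dirichlet ground-state energy in the box of side `(N/ρ)^{1/3}` contains a legitimate Bose trial
state all of whose one-particle modes carry at most `⌊N/q³⌋ + 1` particles — `q³` Dirichlet
near-minimisers in corridor-separated sub-cubes, merged (`window_iInf_maxOccupation_le_cells`);
the extra energy of the internal walls is `o(N)` by the existence and continuity of the
thermodynamic limit below `ρ_c` (tree: `tendsto_energyPerParticleDirichlet_of_lt_criticalDensity`,
`natCast_mul_limsupEnergyPerParticle_le_groundStateEnergy`,
`continuousAt_toReal_limsupEnergyPerParticle`). Hence no criterion of the form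
"`E(Ψ) ≤ E₀ + εN ⟹ maxOccupation Ψ ≥ cN`" holds (`eventually_window_iInf_maxOccupation_le`).
-/

open MeasureTheory ENNReal Filter Topology
open scoped BigOperators

open Literature.MathematicalPhysics.QuantumManyBody.BoseGas

namespace Summit.AtomisticToContinuum.BoseEinsteinCondensation.Theorems

variable {v : ℝ → ℝ≥0∞}

/-! ### Distributing `N` particles over `s` cells -/

/-- `#{c < s : c < r} = r` for `r < s`. -/
theorem soloFrag_card_filter_val_lt {s r : ℕ} (hr : r < s) :
    (Finset.univ.filter fun c : Fin s => (c : ℕ) < r).card = r := by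
  have : (Finset.univ.filter fun c : Fin s => (c : ℕ) < r) = Finset.Iio (⟨r, hr⟩ : Fin s) := by
    ext c
    simp [Fin.lt_def]
  rw [this, Fin.card_Iio]

/-- `∑_{c < s} [c < r] = r` for `r < s`. -/
theorem soloFrag_sum_ite_val_lt {s r : ℕ} (hr : r < s) :
    ∑ c : Fin s, (if (c : ℕ) < r then 1 else 0) = r := by
  simp only [Finset.sum_boole, Nat.cast_id, soloFrag_card_filter_val_lt hr]

/-- The cell occupation numbers `⌊N/s⌋ + [c < N mod s]` add up to `N` (for `s ≥ 1`). -/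
theorem soloFrag_sum_cellCount {s : ℕ} (hs : 0 < s) (N : ℕ) :
    ∑ c : Fin s, (N / s + if (c : ℕ) < N % s then 1 else 0) = N := by
  simp only [Finset.sum_add_distrib, Finset.sum_const, Finset.card_univ,
    Fintype.card_fin, smul_eq_mul]
  rw [soloFrag_sum_ite_val_lt (Nat.mod_lt N hs)]
  exact Nat.div_add_mod N s

/-- Each cell holds at most `⌊N/s⌋ + 1` particles. -/
theorem soloFrag_cellCount_le (s N : ℕ) (c : Fin s) :
    (N / s + if (c : ℕ) < N % s then 1 else 0) ≤ N / s + 1 := by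
  split_ifs <;> omega

/-- Each cell holds at least `⌊N/s⌋` particles. -/
theorem soloFrag_div_le_cellCount (s N : ℕ) (c : Fin s) :
    N / s ≤ N / s + if (c : ℕ) < N % s then 1 else 0 := by
  split_ifs <;> omega

/-! ### Small real-analysis helpers -/

/-- `L_ρ(n) ≤ t` as soon as `n/ρ ≤ t³`. -/
theorem soloFrag_sideLength_le_of_le_pow {ρ t : ℝ} {n : ℕ} (ht : 0 ≤ t) (h : (n : ℝ) / ρ ≤ t ^ 3)
    (h0 : 0 ≤ (n : ℝ) / ρ) : sideLength ρ n ≤ t := by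
  unfold sideLength
  calc ((n : ℝ) / ρ) ^ (1 / 3 : ℝ) ≤ (t ^ 3) ^ (1 / 3 : ℝ) :=
        Real.rpow_le_rpow h0 h (by norm_num)
    _ = t := by rw [← Real.rpow_natCast, ← Real.rpow_mul ht]; norm_num

/-- `E₀^D(n, L_ρ(n)) = n · e_n(ρ)` for `n ≥ 1`. -/
theorem soloFrag_groundStateEnergy_sideLength_eq (v : ℝ → ℝ≥0∞) (ρ : ℝ) {n : ℕ} (hn : 0 < n) :
    groundStateEnergy v n (sideLength ρ n) = n * energyPerParticleDirichlet v ρ n := by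
  rw [energyPerParticleDirichlet, ENNReal.mul_div_cancel (by exact_mod_cast hn.ne')
    (ENNReal.natCast_ne_top n)]

/-- Densities strictly below a finite-energy density are below the critical density. -/
theorem soloFrag_ofReal_lt_criticalDensity_of_lt {ρ ρ₁ : ℝ} (hρ₁ : 0 < ρ₁)
    (hfin : limsupEnergyPerParticle v ρ₁ < ⊤) (h : ρ < ρ₁) :
    ENNReal.ofReal ρ < criticalDensity v := by
  refine lt_of_lt_of_le ((ENNReal.ofReal_lt_ofReal_iff hρ₁).2 h) ?_
  rw [criticalDensity]
  exact le_iSup₂ (f := fun (x : ℝ) (_ : 0 < x ∧ limsupEnergyPerParticle v x < ⊤) =>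
    ENNReal.ofReal x) ρ₁ ⟨hρ₁, hfin⟩

/-! ### The thermodynamic step -/

/-- **No energy window of width `εN` certifies a condensate fraction** (paper Prop. 11.1(c)).
For `v` repulsive of finite range, `0 < ρ < ρ_c(v)`, `q ≥ 1`, `ε > 0`: eventually in `N`, the
infimum of `maxOccupation` over the Dirichlet trial states of `N` bosons in the box of side
`(N/ρ)^{1/3}` with energy `≤ E₀^D + εN` is at most `⌊N/q³⌋ + 1`. -/
theorem eventually_window_iInf_maxOccupation_le (hv : IsRepulsiveFiniteRange v) {ρ : ℝ}
    (hρ : 0 < ρ) (hcap : ENNReal.ofReal ρ < criticalDensity v) {q : ℕ} (hq : 0 < q) {ε : ℝ}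
    (hε : 0 < ε) :
    ∀ᶠ N : ℕ in atTop,
      ⨅ (Θ : TrialState N (sideLength ρ N))
        (_ : energy v Θ ≤ groundStateEnergy v N (sideLength ρ N) + ENNReal.ofReal ε * N),
        maxOccupation N Θ.ψ ≤ ((N / q ^ 3 + 1 : ℕ) : ℝ≥0∞) := by
  obtain ⟨R, hR, hv0⟩ := hv.exists_pos_range
  set E := limsupEnergyPerParticle v with hEdef
  -- room above `ρ` below the critical density
  have hcap' := hcap
  rw [criticalDensity] at hcap'
  simp only [lt_iSup_iff, exists_prop] at hcap'
  obtain ⟨ρ₁, ⟨hρ₁, hfin₁⟩, hρρ₁⟩ := hcap'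
  rw [ENNReal.ofReal_lt_ofReal_iff hρ₁] at hρρ₁
  -- continuity of `e` at `ρ`
  have hcont := continuousAt_toReal_limsupEnergyPerParticle hv hρ hcap
  rw [Metric.continuousAt_iff] at hcont
  obtain ⟨θ, hθ, hθE⟩ := hcont (ε / 4) (by positivity)
  -- the two comparison densities `ρ'' < ρ < ρ'`
  have hmin₁l := min_le_left (θ / 2) ((ρ₁ - ρ) / 2)
  have hmin₁r := min_le_right (θ / 2) ((ρ₁ - ρ) / 2)
  have hδ₁pos : 0 < min (θ / 2) ((ρ₁ - ρ) / 2) := lt_min (by positivity) (by linarith)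
  set ρ' : ℝ := ρ + min (θ / 2) ((ρ₁ - ρ) / 2) with hρ'def
  have hρρ' : ρ < ρ' := by rw [hρ'def]; linarith
  have hρ'ρ₁ : ρ' < ρ₁ := by rw [hρ'def]; linarith
  have hρ'pos : 0 < ρ' := hρ.trans hρρ'
  have hdist' : dist ρ' ρ < θ := by
    rw [Real.dist_eq, abs_of_pos (by linarith), hρ'def]
    linarith
  have hmin₂l := min_le_left (θ / 2) (ρ / 2)
  have hmin₂r := min_le_right (θ / 2) (ρ / 2)
  have hδ₂pos : 0 < min (θ / 2) (ρ / 2) := lt_min (by positivity) (by positivity)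
  set ρ'' : ℝ := ρ - min (θ / 2) (ρ / 2) with hρ''def
  have hρ''pos : 0 < ρ'' := by rw [hρ''def]; linarith
  have hρ''ρ : ρ'' < ρ := by rw [hρ''def]; linarith
  have hdist'' : dist ρ'' ρ < θ := by
    rw [Real.dist_eq, abs_of_neg (by linarith), hρ''def]
    linarith
  -- finiteness and the real-valued comparison
  have hcapρ' : ENNReal.ofReal ρ' < criticalDensity v :=
    soloFrag_ofReal_lt_criticalDensity_of_lt hρ₁ hfin₁ hρ'ρ₁
  have hfin' : E ρ' < ⊤ := (limsupEnergyPerParticle_mono v hρ'pos hρ'ρ₁.le).trans_lt hfin₁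
  have hfin'' : E ρ'' < ⊤ :=
    (limsupEnergyPerParticle_mono v hρ''pos (hρ''ρ.le.trans hρρ'.le)).trans_lt hfin'
  have hE' : (E ρ').toReal < (E ρ).toReal + ε / 4 := by
    have := hθE hdist'
    simp only [Real.dist_eq] at this
    linarith [(abs_lt.1 this).2]
  have hE'' : (E ρ).toReal - ε / 4 < (E ρ'').toReal := by
    have := hθE hdist''
    simp only [Real.dist_eq] at this
    linarith [(abs_lt.1 this).1]
  have hkey : E ρ' + ENNReal.ofReal (ε / 4) ≤ E ρ'' + ENNReal.ofReal ε := by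
    rw [← ENNReal.ofReal_toReal hfin'.ne, ← ENNReal.ofReal_toReal hfin''.ne,
      ← ENNReal.ofReal_add ENNReal.toReal_nonneg (by positivity),
      ← ENNReal.ofReal_add ENNReal.toReal_nonneg hε.le]
    exact ENNReal.ofReal_le_ofReal (by linarith)
  -- (A) per-particle energies at `ρ'` are eventually below `E ρ' + ε/4`
  set e₁ : ℝ≥0∞ := E ρ' + ENNReal.ofReal (ε / 4) with he₁
  have hlt₁ : E ρ' < e₁ :=
    ENNReal.lt_add_right hfin'.ne (ENNReal.ofReal_pos.2 (by positivity)).ne'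
  have hevA : ∀ᶠ n : ℕ in atTop, energyPerParticleDirichlet v ρ' n < e₁ :=
    (tendsto_energyPerParticleDirichlet_of_lt_criticalDensity hv hρ'pos hcapρ').eventually
      (gt_mem_nhds hlt₁)
  obtain ⟨n₀, hn₀⟩ := eventually_atTop.1 hevA
  -- geometric constants
  set s : ℕ := q ^ 3 with hsdef
  have hs : 0 < s := pow_pos hq 3
  have hs' : (0 : ℝ) < s := by exact_mod_cast hs
  have hq' : (0 : ℝ) < q := by exact_mod_cast hq
  set κ : ℝ := (1 + ρ / ρ') / 2 with hκ
  have hρdiv : ρ / ρ' < 1 := (div_lt_one hρ'pos).2 hρρ'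
  have hκ1 : κ < 1 := by rw [hκ]; linarith
  have hκpos : 0 < κ := by positivity
  have hκρ : ρ < κ * ρ' := by
    rw [hκ]
    have : (1 + ρ / ρ') / 2 * ρ' = (ρ' + ρ) / 2 := by field_simp
    rw [this]
    linarith
  set μ : ℝ := κ ^ (1 / 3 : ℝ) with hμ
  have hμ1 : μ < 1 := Real.rpow_lt_one hκpos.le hκ1 (by norm_num)
  have hμpos : 0 < μ := Real.rpow_pos_of_pos hκpos _
  have hμ3 : μ ^ 3 = κ := by
    rw [hμ, ← Real.rpow_natCast, ← Real.rpow_mul hκpos.le]; norm_num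
  set ν : ℝ := (ρ / ρ'') ^ (1 / 3 : ℝ) with hν
  have hν1 : 1 < ν := Real.one_lt_rpow ((one_lt_div hρ''pos).2 hρ''ρ) (by norm_num)
  have hν3 : ν ^ 3 = ρ / ρ'' := by
    rw [hν, ← Real.rpow_natCast, ← Real.rpow_mul (by positivity)]; norm_num
  -- eventual conditions on `N`
  have hev1 : ∀ᶠ N : ℕ in atTop, ρ * s / (κ * ρ' - ρ) ≤ (N : ℝ) :=
    tendsto_natCast_atTop_atTop.eventually_ge_atTop _
  have hev2 : ∀ᶠ N : ℕ in atTop, s * max n₀ 1 ≤ N := eventually_ge_atTop _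
  have hev3 : ∀ᶠ N : ℕ in atTop, max (q * R / (1 - μ)) (2 * R / (ν - 1)) ≤ sideLength ρ N :=
    (tendsto_sideLength_atTop hρ).eventually_ge_atTop _
  filter_upwards [hev1, hev2, hev3] with N h1 h2 h3
  -- a fixed large `N`
  set L := sideLength ρ N with hLdef
  have hL3 : L ^ 3 = N / ρ := sideLength_pow_three hρ N
  have hLq : q * R / (1 - μ) ≤ L := (le_max_left _ _).trans h3
  have hLν : 2 * R / (ν - 1) ≤ L := (le_max_right _ _).trans h3
  have h1μ : 0 < 1 - μ := by linarith
  have hLpos : 0 < L := lt_of_lt_of_le (div_pos (mul_pos hq' hR) h1μ) hLq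
  have hρne : ρ ≠ 0 := hρ.ne'
  have hρ'ne : ρ' ≠ 0 := hρ'pos.ne'
  have hρ''ne : ρ'' ≠ 0 := hρ''pos.ne'
  have hsne : (s : ℝ) ≠ 0 := hs'.ne'
  have hqne : (q : ℝ) ≠ 0 := hq'.ne'
  have h1' : ρ * s ≤ (κ * ρ' - ρ) * N := by
    have hden : 0 < κ * ρ' - ρ := by linarith
    have := (div_le_iff₀ hden).1 h1
    linarith
  -- the cell side `ℓ = L/q - R`
  set ℓ : ℝ := L / q - R with hℓdef
  have hμL : μ * L / q ≤ ℓ := by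
    have hqR : q * R ≤ L * (1 - μ) := (div_le_iff₀ h1μ).1 hLq
    rw [hℓdef, le_sub_iff_add_le, div_add' _ _ _ hqne]
    gcongr
    linarith
  have hℓpos : 0 < ℓ := lt_of_lt_of_le (div_pos (mul_pos hμpos hLpos) hq') hμL
  have hfit : (q : ℝ) * (ℓ + R) ≤ L := by
    have : (q : ℝ) * (ℓ + R) = L := by
      rw [hℓdef, sub_add_cancel]
      field_simp
    exact this.le
  -- particle numbers
  have hsmax : s ≤ s * max n₀ 1 := Nat.le_mul_of_pos_right s (lt_max_of_lt_right one_pos)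
  have hNs : s ≤ N := hsmax.trans h2
  have hNpos : 0 < N := hs.trans_le hNs
  have hdiv : max n₀ 1 ≤ N / s := (Nat.le_div_iff_mul_le hs).2 (by rw [mul_comm]; exact h2)
  set n : Fin (q ^ 3) → ℕ := fun c => N / s + if (c : ℕ) < N % s then 1 else 0 with hndef
  have hnN : ∑ c, n c = N := soloFrag_sum_cellCount hs N
  have hnle : ∀ c, n c ≤ N / s + 1 := fun c => soloFrag_cellCount_le _ _ c
  have hnge : ∀ c, max n₀ 1 ≤ n c := fun c => hdiv.trans (soloFrag_div_le_cellCount _ _ c)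
  have hnpos : ∀ c, 0 < n c := fun c => lt_of_lt_of_le (lt_max_of_lt_right one_pos) (hnge c)
  have hn₀c : ∀ c, n₀ ≤ n c := fun c => (le_max_left _ _).trans (hnge c)
  -- every cell is at least as large as the `ρ'`-box of its particle number
  have hcell : ∀ c, sideLength ρ' (n c) ≤ ℓ := by
    intro c
    refine soloFrag_sideLength_le_of_le_pow hℓpos.le ?_ (by positivity)
    have hnc : (n c : ℝ) ≤ (N : ℝ) / s + 1 := by
      calc (n c : ℝ) ≤ ((N / s + 1 : ℕ) : ℝ) := by exact_mod_cast hnle c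
        _ = ((N / s : ℕ) : ℝ) + 1 := by push_cast; ring
        _ ≤ (N : ℝ) / s + 1 := by gcongr; exact Nat.cast_div_le
    have step1 : ((N : ℝ) / s + 1) / ρ' ≤ κ * ((N : ℝ) / ρ) / s := by
      have hρN : ρ * ((N : ℝ) + s) ≤ κ * ρ' * N := by linarith
      calc ((N : ℝ) / s + 1) / ρ' = ρ * (N + s) / (ρ * ρ' * s) := by
            field_simp
        _ ≤ κ * ρ' * N / (ρ * ρ' * s) :=
            div_le_div_of_nonneg_right hρN (mul_pos (mul_pos hρ hρ'pos) hs').le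
        _ = κ * ((N : ℝ) / ρ) / s := by
            field_simp
    have step2 : κ * ((N : ℝ) / ρ) / s = (μ * L / q) ^ 3 := by
      rw [← hL3, ← hμ3, hsdef]
      push_cast
      ring
    calc (n c : ℝ) / ρ' ≤ ((N : ℝ) / s + 1) / ρ' := by gcongr
      _ ≤ κ * ((N : ℝ) / ρ) / s := step1
      _ = (μ * L / q) ^ 3 := step2
      _ ≤ ℓ ^ 3 := pow_le_pow_left₀ (by positivity) hμL 3
  -- per-cell energies
  set e : Fin (q ^ 3) → ℝ≥0∞ := fun c => (n c : ℝ≥0∞) * e₁ with hedef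
  have he : ∀ c, groundStateEnergy v (n c) ℓ < e c := by
    intro c
    calc groundStateEnergy v (n c) ℓ ≤ groundStateEnergy v (n c) (sideLength ρ' (n c)) :=
          groundStateEnergy_anti v (n c) (hcell c)
      _ = (n c : ℝ≥0∞) * energyPerParticleDirichlet v ρ' (n c) :=
          soloFrag_groundStateEnergy_sideLength_eq v ρ' (hnpos c)
      _ < (n c : ℝ≥0∞) * e₁ := by
          have h0 : (n c : ℝ≥0∞) ≠ 0 := by exact_mod_cast (hnpos c).ne'
          simpa only [mul_comm] using
            (ENNReal.mul_left_strictMono h0 (ENNReal.natCast_ne_top _)) (hn₀ _ (hn₀c c))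
  -- Ruelle's lower bound at the big box: `N · e(ρ'') ≤ E₀^D(N, L)`
  have hdens : ρ'' ≤ (N : ℝ) / (L + 2 * R) ^ 3 := by
    rw [le_div_iff₀ (pow_pos (by linarith) 3)]
    have hν1' : 0 < ν - 1 := by linarith
    have h2R : 2 * R ≤ L * (ν - 1) := (div_le_iff₀ hν1').1 hLν
    have hLR : L + 2 * R ≤ ν * L := by linarith
    calc ρ'' * (L + 2 * R) ^ 3 ≤ ρ'' * (ν * L) ^ 3 :=
          mul_le_mul_of_nonneg_left (pow_le_pow_left₀ (by linarith) hLR 3) hρ''pos.le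
      _ = ρ'' * ν ^ 3 * L ^ 3 := by ring
      _ = (N : ℝ) := by
          rw [hν3, hL3]
          field_simp
  have hlow : (N : ℝ≥0∞) * E ρ'' ≤ groundStateEnergy v N L := by
    refine le_trans ?_
      (natCast_mul_limsupEnergyPerParticle_le_groundStateEnergy hv.1 hv0 hR hNpos hLpos)
    exact mul_le_mul' le_rfl (limsupEnergyPerParticle_mono v hρ''pos hdens)
  -- the window `εN` is wide enough for the cell sum
  have hw : ∑ c, e c ≤ groundStateEnergy v N L + ENNReal.ofReal ε * N := by
    have hsum : ∑ c, e c = (N : ℝ≥0∞) * e₁ := by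
      rw [hedef]
      simp only
      rw [← Finset.sum_mul, ← Nat.cast_sum, hnN]
    rw [hsum, he₁]
    calc (N : ℝ≥0∞) * (E ρ' + ENNReal.ofReal (ε / 4))
        ≤ N * (E ρ'' + ENNReal.ofReal ε) := mul_le_mul' le_rfl hkey
      _ = N * E ρ'' + ENNReal.ofReal ε * N := by ring
      _ ≤ groundStateEnergy v N L + ENNReal.ofReal ε * N := add_le_add hlow le_rfl
  exact window_iInf_maxOccupation_le_cells hv.1 hv0 hR.le hℓpos (m := q) hfit n hnN e he hw hnle

end Summit.AtomisticToContinuum.BoseEinsteinCondensation.Theorems
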